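import Summits.BirchSwinnertonDyer.BirchSwinnertonDyer.Theorems.TameQuarticManinParityTprimeSubrowBTransport
import HarnessLib

/-!
# Route `TameQuarticManinParity`, LINE 23 (bsd-idea-3 g8), analytic half of W23b / W23a on the TAME sub-row, part 2:
# Serre's additive embedding `θ : E[3] ↪ k`, `ψ₂⁷`-equivariant on Kodaira III and `ψ₂³`-equivariant on III*, and
# Serre weight `6` (III) / `2` (III*) at the canonical local datum (`--supports` W23b stmt-BirchSwinnertonDyer-28281;
# also W23a stmt-28283)

Cell `pub/bsd-wall`, D-0145 line `route-BirchSwinnertonDyer-TeichmullerTwistDescent`, seat `bsd-line-ttd-p1` g11.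
THEOREMS ONLY (no definition, no named fact, no `sorry`; axioms `propext`, `Classical.choice`, `Quot.sound`).
BSD is NOT proved by this; Manin's conjecture is not proved; the route items W23b (28281) / W23a (28283) stay OPEN
as typed (they quantify over every abstract `LocalRestrictionAt`; here: the canonical datum `ℚ_v`, `v ∣ 3`, and only
sub-row B of the cell's `(c₄, c₆)` split — the TAME rows, `ℚ₃(E[3])/ℚ₃^{nr}` of degree `8`, no canonical subgroup).

## Statement

For `W/ℚ` globally minimal elliptic with `Addv W 3`, `SubTprime W 3` (class (t′): `ord₃ Δ_min ∈ {3, 9}`, `e = 4`,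
potentially supersingular) on sub-row B (`c₆ = 0 ∨ 2·ord₃ c₆ ≠ ord₃ Δ + 3`), the place `v` over `3` (`#k_v = 3`,
uniformiser `3`) and `ψ₂ : I_{ℚ_v} → k×` the level-two fundamental character (Kummer character of `π`, `π⁸ = 3`):
there is `θ : E(ℚ̄) → k`, additive and injective on `E[3]`, with `θ(σ X) = ψ₂(σ)⁷ θ(X)` on Kodaira III
(`ord₃ Δ = 3`) and `θ(σ X) = ψ₂(σ)³ θ(X)` on Kodaira III* (`ord₃ Δ = 9`) —
`exists_additive_equivariant_of_tprime_subrowB`. With the landed representation-theoretic halves (seat g10,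
`WeierstrassCurve.serreWeight_eq_six_of_additive_equivariant_pow_seven` / `…_eq_two_of_additive_equivariant_pow`):
**Serre weight `6` on type III** (`serreWeight_eq_six_of_tprime_kodairaIII_subrowB`) and **`2` on type III***
(`serreWeight_eq_two_of_tprime_kodairaIIIstar_subrowB`), for every framing of `E[3]`, every `j : 𝔽₃ → k`, every
residue embedding. Irreducibility of `E[3]` is not used. «Kraus at `p = 3`, `e = 4`»: not in print in this form
(Kraus, Dissertationes Math. 364, treats `p ≥ 5`); elementary after Serre 1972 §1.

## Proof

With `ϖ = π²` and the transport `A : E(ℚ̄) → W'(K̄_v)` of part 1 (`exists_tprime_subrowB_transport`: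
`A(E[3]) ⊂ E₁(W')`, `|z(A X)| = |π|` on `E[3] ∖ 0`, `z(A σX) = (ϖ/σϖ)ᵏ · σ z(A X)`), put
`θ(X) = ι(z(A X)/π mod 𝔓)`. Additivity: `z` is additive to first order on `E₁` (`val_zCoord_add_sub_le`, error
`≤ |π|² < |π|`). Injectivity: `|z(A X)/π| = 1` off `0`. Equivariance, for `σ ∈ I`:
`z(A σX)/π = (ϖ/σϖ)ᵏ · (σ z_A/z_A) · (z_A/π)` with `ι(σ z_A/z_A mod 𝔓) = ψ₂(σ)` (Serre's Lemma
`coe_kummerCharacter_eq_residue_smul_div`, as `|z_A| = |π|`) and `ι(ϖ/σϖ mod 𝔓) = ι((π/σπ)² mod 𝔓) = ψ₂(σ)⁻²`,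
so the character is `ψ₂^{1-2k}` = `ψ₂⁷` (`k = 1`) / `ψ₂³` (`k = 3`) by `ψ₂⁸ = 1`.

References: J.-P. Serre, Invent. Math. 15 (1972) §1.3, §1.7 Prop. 3, §1.10–1.11; J.-P. Serre, Duke Math. J. 54 (1987)
§2.2, §2.8; A. Kraus, Dissertationes Math. 364 (1997); J. H. Silverman, *AEC* IV.6.1, VII.2.
[cite: SerreInventiones1972, §1.7 Prop. 3, §1.11 Prop. 12] [cite: Serre1987, §2.2 (2.2.4), §2.8 (2.8.1)]
-/

set_option linter.dupNamespace false
set_option autoImplicit false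

noncomputable section

open scoped Classical NNReal NumberField

namespace Summit.BirchSwinnertonDyer.BirchSwinnertonDyer.Theorems.TameQuarticManinParity

open _root_.WeierstrassCurve Literature.NumberTheory.GaloisRepresentations Field
  IsDedekindDomain IsDedekindDomain.HeightOneSpectrum Rat.HeightOneSpectrum
  Literature.NumberTheory.EllipticCurves
  Literature.NumberTheory.GaloisRepresentations.IsNonarchimedeanLocalField
  Literature.NumberTheory.GaloisRepresentations.ModPGaloisRep ValuativeRel

set_option maxHeartbeats 800000 in
/-- **Serre's additive embedding for the tame quartic class at `3`, sub-row B.** For `W/ℚ` globally minimal elliptic,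
`Addv W 3`, `SubTprime W 3`, sub-row B (`c₆ = 0 ∨ 2·ord₃ c₆ ≠ ord₃ Δ + 3`), the place `v` over `3` with `#k_v = 3` and
uniformiser `3`, and any residue embedding `ι`: there are `e ∈ {7, 3}` — `e = 7` iff `ord₃ Δ = 3` (type III), `e = 3`
iff `ord₃ Δ = 9` (type III*) — and `θ : E(ℚ̄) → k`, additive and injective on `E[3]`, with `θ(σ X) = ψ₂(σ)ᵉ θ(X)`
for `σ` in the inertia group of `ℚ_v` (`ψ₂` the level-two fundamental character w.r.t. the uniformiser `3`).
[cite: SerreInventiones1972, §1.7 Prop. 3, §1.10 Prop. 10, §1.11 Prop. 12] [cite: SilvermanAEC2009, Prop. VII.2.2] -/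
theorem exists_additive_equivariant_of_tprime_subrowB
    (W : WeierstrassCurve ℚ) [W.IsElliptic] [W.IsGloballyMinimal]
    (hadd : Rank1Residual.Addv W 3) (hsub : Summit.BirchSwinnertonDyer.Rank1Residual.Additive.SubTprime W 3)
    (hB : W.c₆ = 0 ∨ 2 * padicValRat 3 W.c₆ ≠ padicValRat 3 W.Δ + 3)
    (v : HeightOneSpectrum (𝓞 ℚ)) (hv : (primesEquiv v : ℕ) = 3)
    {k : Type} [Field k]
    (hirr : Irreducible ((3 : ℕ) : 𝒪[v.adicCompletion ℚ]))
    (hq : residueFieldCard (v.adicCompletion ℚ) = 3)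
    (ι : absIntegers 𝒪[v.adicCompletion ℚ] (v.adicCompletion ℚ) ⧸
      absMaximalIdeal (v.adicCompletion ℚ) →+* k) :
    ∃ e : ℕ, ((padicValRat 3 W.Δ = 3 ∧ e = 7) ∨ (padicValRat 3 W.Δ = 9 ∧ e = 3)) ∧
    ∃ θ : geomPoints W → k,
      (∀ X ∈ geomTorsion W 3, ∀ Y ∈ geomTorsion W 3, θ (X + Y) = θ X + θ Y) ∧
      (∀ X ∈ geomTorsion W 3, θ X = 0 → X = 0) ∧
      (∀ (σ : absInertia (v.adicCompletion ℚ)), ∀ X ∈ geomTorsion W 3,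
        θ (absGaloisRestrict ℚ (v.adicCompletion ℚ)
            (σ : absoluteGaloisGroup (v.adicCompletion ℚ)) • X) =
          (fundamentalCharacter (v.adicCompletion ℚ) 2 ι ((3 : ℕ) : 𝒪[v.adicCompletion ℚ])
            hirr σ : k) ^ e * θ X) := by
  classical
  haveI : Fact (Nat.Prime 3) := ⟨Nat.prime_three⟩
  have hpv : ((3 : ℕ) : 𝓞 ℚ) ∈ v.asIdeal := by
    have h : v = (primesEquiv (R := 𝓞 ℚ)).symm ⟨3, Nat.prime_three⟩ := by
      rw [Equiv.eq_symm_apply]; exact Subtype.ext hv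
    exact (natCast_mem_asIdeal_iff_eq_primesEquiv_symm v Nat.prime_three).mpr h
  /- Step 0: the spectral valuation `w`, the Kummer root `π` (`π⁸ = 3`), `ϖ = π²`. -/
  obtain ⟨w, hw⟩ := v.exists_spectralValuation
  have h3w : w ((3 : ℕ) : AlgebraicClosure (v.adicCompletion ℚ)) < 1 := by
    have h := spectralValuation_algebraMap_ringOfIntegers_lt_one (v := v) hw hpv
    rwa [map_natCast] at h
  have hn : 0 < residueFieldCard (v.adicCompletion ℚ) ^ 2 - 1 :=
    residueFieldCard_pow_sub_one_pos (v.adicCompletion ℚ) two_ne_zero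
  have hn8 : residueFieldCard (v.adicCompletion ℚ) ^ 2 - 1 = 8 := by rw [hq]; norm_num
  set π : AlgebraicClosure (v.adicCompletion ℚ) :=
    (kummerRoot (v.adicCompletion ℚ) hn ((3 : ℕ) : 𝒪[v.adicCompletion ℚ]) :
      AlgebraicClosure (v.adicCompletion ℚ)) with hπdef
  have hπ0 : π ≠ 0 := coe_kummerRoot_ne_zero hn hirr.ne_zero
  have hπ8 : π ^ 8 = ((3 : ℕ) : AlgebraicClosure (v.adicCompletion ℚ)) := by
    rw [← hn8, hπdef, coe_kummerRoot_pow, map_natCast]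
  have hwπ8 : w π ^ 8 = w ((3 : ℕ) : AlgebraicClosure (v.adicCompletion ℚ)) := by
    rw [← Valuation.map_pow, hπ8]
  have hwπ1 : w π < 1 := by
    by_contra hle
    rw [not_lt] at hle
    have : 1 ≤ w π ^ 8 := one_le_pow₀ hle
    rw [hwπ8] at this
    exact absurd h3w (not_lt.mpr this)
  have hwπ0 : 0 < w π := (Valuation.pos_iff _).mpr hπ0
  set ϖL : AlgebraicClosure (v.adicCompletion ℚ) := π ^ 2 with hϖLdef
  have hϖL4 : ϖL ^ 4 = ((3 : ℕ) : AlgebraicClosure (v.adicCompletion ℚ)) := by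
    rw [hϖLdef, ← pow_mul]; exact hπ8
  have hwϖ : w ϖL = w π ^ 2 := by rw [hϖLdef, Valuation.map_pow]
  have hϖL0 : ϖL ≠ 0 := by rw [hϖLdef]; exact pow_ne_zero _ hπ0
  /- Step 1: the transport of part 1. -/
  obtain ⟨kk, W'L, hint, A, hkm, hAinj, hker, hwz2, hzσ⟩ :=
    exists_tprime_subrowB_transport W hadd hsub hB v hv hw hϖL4
  haveI := hint
  have hwz : ∀ X ∈ geomTorsion W 3, X ≠ 0 → w (A X).zCoord = w π := by
    intro X hXt hX0
    have h := hwz2 X hXt hX0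
    rw [hwϖ] at h
    exact (pow_left_inj₀ zero_le zero_le two_ne_zero).mp h
  have hwz_le : ∀ X ∈ geomTorsion W 3, w (A X).zCoord ≤ w π := by
    intro X hXt
    by_cases hX0 : X = 0
    · subst hX0; rw [A.map_zero, Affine.Point.zCoord_zero, _root_.map_zero]; exact zero_le
    · exact (hwz X hXt hX0).le
  /- Step 6: norms for the residue calculus (`algNorm` = the GalRep absolute value on `K̄_v`). -/
  have hnp : residueFieldCard (v.adicCompletion ℚ) ^ 2 - 1 = 8 := hn8
  have hπnorm : algNorm (v.adicCompletion ℚ) π ^ (residueFieldCard (v.adicCompletion ℚ) ^ 2 - 1) =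
      algNorm (v.adicCompletion ℚ) (algebraMap 𝒪[v.adicCompletion ℚ] (AlgebraicClosure (v.adicCompletion ℚ))
        ((3 : ℕ) : 𝒪[v.adicCompletion ℚ])) := by
    rw [hπdef, algNorm_kummerRoot_pow]
  have hnz : ∀ X ∈ geomTorsion W 3, X ≠ 0 →
      algNorm (v.adicCompletion ℚ) (A X).zCoord = algNorm (v.adicCompletion ℚ) π := by
    intro X hXt hX0
    exact le_antisymm ((spectralValuation_le_iff_algNorm_le hw _ _).mp (hwz X hXt hX0).le)
      ((spectralValuation_le_iff_algNorm_le hw _ _).mp (hwz X hXt hX0).ge)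
  have hπn0 : algNorm (v.adicCompletion ℚ) π ≠ 0 := (algNorm_pos_iff.mpr hπ0).ne'
  have hnorm_div : ∀ X ∈ geomTorsion W 3, algNorm (v.adicCompletion ℚ) ((A X).zCoord / π) ≤ 1 := by
    intro X hXt
    by_cases hX0 : X = 0
    · subst hX0; rw [A.map_zero, Affine.Point.zCoord_zero, zero_div, algNorm_zero]; exact zero_le_one
    · rw [algNorm_div, hnz X hXt hX0, div_self hπn0]
  -- residues of powers of elements of norm `≤ 1`
  have hrespow : ∀ (a : AlgebraicClosure (v.adicCompletion ℚ)), algNorm (v.adicCompletion ℚ) a ≤ 1 →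
      ∀ n : ℕ, IsNonarchimedeanLocalField.residue (v.adicCompletion ℚ) (a ^ n) =
        IsNonarchimedeanLocalField.residue (v.adicCompletion ℚ) a ^ n := by
    intro a ha n
    induction n with
    | zero => rw [pow_zero, pow_zero, residue_one]
    | succ n ih =>
      rw [pow_succ, pow_succ, residue_mul ?_ ha, ih]
      rw [algNorm_pow]; exact pow_le_one₀ (algNorm_nonneg _) ha
  /- Step 7: the map `θ : E[3] → k`, `X ↦ ι(z(A X)/π mod 𝔓)`. -/
  let θ : geomPoints W → k := fun X ↦
    ι (IsNonarchimedeanLocalField.residue (v.adicCompletion ℚ) ((A X).zCoord / π))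
  have hθdef : ∀ X, θ X =
      ι (IsNonarchimedeanLocalField.residue (v.adicCompletion ℚ) ((A X).zCoord / π)) := fun X ↦ rfl
  have hθ0 : θ 0 = 0 := by
    rw [hθdef, A.map_zero, Affine.Point.zCoord_zero, zero_div, residue_zero, ι.map_zero]
  -- additivity
  have hθadd : ∀ X ∈ geomTorsion W 3, ∀ Y ∈ geomTorsion W 3, θ (X + Y) = θ X + θ Y := by
    intro X hXt Y hYt
    rw [hθdef, hθdef, hθdef, ← ι.map_add, A.map_add]
    congr 1
    set err := (A X + A Y).zCoord - (A X).zCoord - (A Y).zCoord with herr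
    have herr_le : w err ≤ w π ^ 2 :=
      (FormalGroupChart.val_zCoord_add_sub_le (hker X hXt) (hker Y hYt)).trans
        (pow_le_pow_left' (max_le (hwz_le X hXt) (hwz_le Y hYt)) 2)
    have herr_div_w : w (err / π) < 1 := by
      rw [map_div₀]
      calc w err / w π ≤ w π ^ 2 / w π := by gcongr
        _ = w π := by rw [sq, mul_div_cancel_right₀ _ hwπ0.ne']
        _ < 1 := hwπ1
    have herr_div : algNorm (v.adicCompletion ℚ) (err / π) < 1 :=
      (spectralValuation_lt_one_iff_algNorm_lt_one hw _).mp herr_div_w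
    have hsplit : (A X + A Y).zCoord / π = ((A X).zCoord / π + (A Y).zCoord / π) + err / π := by
      rw [herr]; ring
    have hsum_le : algNorm (v.adicCompletion ℚ) ((A X).zCoord / π + (A Y).zCoord / π) ≤ 1 :=
      (algNorm_add_le _ _).trans (max_le (hnorm_div X hXt) (hnorm_div Y hYt))
    rw [hsplit, residue_add hsum_le herr_div.le, residue_add (hnorm_div X hXt) (hnorm_div Y hYt),
      (residue_eq_zero_iff herr_div.le).mpr herr_div, add_zero]
  -- injectivity
  have hθinj : ∀ X ∈ geomTorsion W 3, θ X = 0 → X = 0 := by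
    intro X hXt hθX
    by_contra hX0
    have h1 : algNorm (v.adicCompletion ℚ) ((A X).zCoord / π) = 1 := by
      rw [algNorm_div, hnz X hXt hX0, div_self hπn0]
    have h2 : IsNonarchimedeanLocalField.residue (v.adicCompletion ℚ) ((A X).zCoord / π) ≠ 0 := by
      intro h0
      rw [residue_eq_zero_iff h1.le, h1] at h0
      exact lt_irrefl _ h0
    rw [hθdef] at hθX
    exact h2 (residueEmbedding_injective ι (by rw [ι.map_zero]; exact hθX))
  /- Step 8: equivariance under inertia, `θ(σ X) = ψ₂(σ)^{1-2k} θ(X)`. -/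
  have hone : ∀ σ : absInertia (v.adicCompletion ℚ),
      ((fundamentalCharacter (v.adicCompletion ℚ) 2 ι ((3 : ℕ) : 𝒪[v.adicCompletion ℚ]) hirr σ : kˣ) : k) ^ 8
        = 1 := by
    intro σ
    have h := InertiaShape.fundamentalCharacter_pow_eq_one (F := v.adicCompletion ℚ) (k := k) (m := 2)
      two_ne_zero ι ((3 : ℕ) : 𝒪[v.adicCompletion ℚ]) hirr
    have h' := congrArg (fun χ : absInertia (v.adicCompletion ℚ) →* kˣ ↦ ((χ σ : kˣ) : k)) h
    simp only [MonoidHom.pow_apply, Units.val_pow_eq_pow_val, MonoidHom.one_apply, Units.val_one, hq] at h'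
    norm_num at h'
    exact h'
  -- the Kummer reading: `ι(σ z / z mod 𝔓) = ψ₂(σ)` for every `z` with `|z| = |π|`
  have hkum : ∀ (σ : absInertia (v.adicCompletion ℚ)) (z : AlgebraicClosure (v.adicCompletion ℚ)),
      algNorm (v.adicCompletion ℚ) z = algNorm (v.adicCompletion ℚ) π →
      ι (IsNonarchimedeanLocalField.residue (v.adicCompletion ℚ)
          ((σ : absoluteGaloisGroup (v.adicCompletion ℚ)) • z / z)) =
        (fundamentalCharacter (v.adicCompletion ℚ) 2 ι ((3 : ℕ) : 𝒪[v.adicCompletion ℚ]) hirr σ : k) := by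
    intro σ z hz
    rw [fundamentalCharacter_of_ne_zero (v.adicCompletion ℚ) two_ne_zero,
      coe_kummerCharacter_eq_residue_smul_div hn hirr.ne_zero ι σ]
    rw [hz]
    exact hπnorm
  -- `ι(π / σ π mod 𝔓) = ψ₂(σ)⁻¹`
  have hkum_inv : ∀ σ : absInertia (v.adicCompletion ℚ),
      ι (IsNonarchimedeanLocalField.residue (v.adicCompletion ℚ)
          (π / ((σ : absoluteGaloisGroup (v.adicCompletion ℚ)) • π))) =
        ((fundamentalCharacter (v.adicCompletion ℚ) 2 ι ((3 : ℕ) : 𝒪[v.adicCompletion ℚ]) hirr σ : k))⁻¹ := by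
    intro σ
    have hσπ0 : (σ : absoluteGaloisGroup (v.adicCompletion ℚ)) • π ≠ 0 := by
      rw [absoluteGaloisGroup.smul_def]; exact (map_ne_zero _).mpr hπ0
    have h1 : algNorm (v.adicCompletion ℚ) (π / ((σ : absoluteGaloisGroup (v.adicCompletion ℚ)) • π)) ≤ 1 := by
      rw [algNorm_div, algNorm_smul, div_self hπn0]
    have h2 : algNorm (v.adicCompletion ℚ) (((σ : absoluteGaloisGroup (v.adicCompletion ℚ)) • π) / π) ≤ 1 :=
      (algNorm_smul_div_self _ hπ0).le
    apply eq_inv_of_mul_eq_one_left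
    rw [← hkum σ π rfl, ← ι.map_mul, ← residue_mul h1 h2, div_mul_div_cancel₀ hσπ0, div_self hπ0, residue_one,
      ι.map_one]
  have hθsmul : ∀ (σ : absInertia (v.adicCompletion ℚ)), ∀ X ∈ geomTorsion W 3,
      θ (absGaloisRestrict ℚ (v.adicCompletion ℚ) (σ : absoluteGaloisGroup (v.adicCompletion ℚ)) • X) =
        (((fundamentalCharacter (v.adicCompletion ℚ) 2 ι ((3 : ℕ) : 𝒪[v.adicCompletion ℚ]) hirr σ : k))⁻¹
          ^ (2 * kk) *
          (fundamentalCharacter (v.adicCompletion ℚ) 2 ι ((3 : ℕ) : 𝒪[v.adicCompletion ℚ]) hirr σ : k)) *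
          θ X := by
    intro σ X hXt
    by_cases hX0 : X = 0
    · subst hX0; rw [smul_zero, hθ0, mul_zero]
    -- the `z`-coordinates
    have hzA0 : (A X).zCoord ≠ 0 := by
      intro h0
      have := hnz X hXt hX0
      rw [h0, algNorm_zero] at this
      exact hπn0 this.symm
    have hσϖ0 : (σ : absoluteGaloisGroup (v.adicCompletion ℚ)) • ϖL ≠ 0 := by
      rw [absoluteGaloisGroup.smul_def]; exact (map_ne_zero _).mpr hϖL0
    have hσπ0 : (σ : absoluteGaloisGroup (v.adicCompletion ℚ)) • π ≠ 0 := by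
      rw [absoluteGaloisGroup.smul_def]; exact (map_ne_zero _).mpr hπ0
    have hkey : (A (absGaloisRestrict ℚ (v.adicCompletion ℚ)
        (σ : absoluteGaloisGroup (v.adicCompletion ℚ)) • X)).zCoord / π =
        ((ϖL / ((σ : absoluteGaloisGroup (v.adicCompletion ℚ)) • ϖL)) ^ kk *
          (((σ : absoluteGaloisGroup (v.adicCompletion ℚ)) • (A X).zCoord) / (A X).zCoord)) *
          ((A X).zCoord / π) := by
      rw [hzσ (σ : absoluteGaloisGroup (v.adicCompletion ℚ)) X, div_pow]
      field_simp
      try ring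
    -- `ϖ / σϖ = (π / σπ)²`
    have hϖπ : ϖL / ((σ : absoluteGaloisGroup (v.adicCompletion ℚ)) • ϖL) =
        (π / ((σ : absoluteGaloisGroup (v.adicCompletion ℚ)) • π)) ^ 2 := by
      rw [hϖLdef, absoluteGaloisGroup.smul_def, map_pow, div_pow, ← absoluteGaloisGroup.smul_def]
    -- norms
    have hn1 : algNorm (v.adicCompletion ℚ) (π / ((σ : absoluteGaloisGroup (v.adicCompletion ℚ)) • π)) ≤ 1 := by
      rw [algNorm_div, algNorm_smul, div_self hπn0]
    have hn2 : algNorm (v.adicCompletion ℚ)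
        ((ϖL / ((σ : absoluteGaloisGroup (v.adicCompletion ℚ)) • ϖL)) ^ kk) ≤ 1 := by
      rw [hϖπ, ← pow_mul, algNorm_pow]
      exact pow_le_one₀ (algNorm_nonneg _) hn1
    have hn3 : algNorm (v.adicCompletion ℚ)
        (((σ : absoluteGaloisGroup (v.adicCompletion ℚ)) • (A X).zCoord) / (A X).zCoord) ≤ 1 :=
      (algNorm_smul_div_self _ hzA0).le
    have hn23 : algNorm (v.adicCompletion ℚ)
        ((ϖL / ((σ : absoluteGaloisGroup (v.adicCompletion ℚ)) • ϖL)) ^ kk *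
          (((σ : absoluteGaloisGroup (v.adicCompletion ℚ)) • (A X).zCoord) / (A X).zCoord)) ≤ 1 := by
      rw [algNorm_mul]; exact mul_le_one₀ hn2 (algNorm_nonneg _) hn3
    rw [hθdef, hθdef, hkey, residue_mul hn23 (hnorm_div X hXt), residue_mul hn2 hn3, ι.map_mul, ι.map_mul,
      hkum σ _ (hnz X hXt hX0), hϖπ, ← pow_mul, hrespow _ hn1, map_pow, hkum_inv σ]
  /- Step 9: the exponent: `ψ₂⁻²ᵏ⁺¹ = ψ₂⁷` for `k = 1` (type III) and `ψ₂³` for `k = 3` (type III*), as `ψ₂⁸ = 1`. -/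
  rcases hkm with ⟨hΔ3, hk1⟩ | ⟨hΔ9, hk3⟩
  · refine ⟨7, Or.inl ⟨hΔ3, rfl⟩, θ, hθadd, hθinj, fun σ X hXt ↦ ?_⟩
    rw [hθsmul σ X hXt, hk1]
    congr 1
    have h8 := hone σ
    set u : k := ((fundamentalCharacter (v.adicCompletion ℚ) 2 ι ((3 : ℕ) : 𝒪[v.adicCompletion ℚ]) hirr σ
      : kˣ) : k) with hu
    have hinv : u⁻¹ = u ^ 7 := inv_eq_of_mul_eq_one_right (by rw [← pow_succ']; exact h8)
    rw [hinv, ← pow_mul, ← pow_succ, show 7 * (2 * 1) + 1 = 8 + 7 by norm_num, pow_add, h8, one_mul]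
  · refine ⟨3, Or.inr ⟨hΔ9, rfl⟩, θ, hθadd, hθinj, fun σ X hXt ↦ ?_⟩
    rw [hθsmul σ X hXt, hk3]
    congr 1
    have h8 := hone σ
    set u : k := ((fundamentalCharacter (v.adicCompletion ℚ) 2 ι ((3 : ℕ) : 𝒪[v.adicCompletion ℚ]) hirr σ
      : kˣ) : k) with hu
    have hinv : u⁻¹ = u ^ 7 := inv_eq_of_mul_eq_one_right (by rw [← pow_succ']; exact h8)
    rw [hinv, ← pow_mul, ← pow_succ, show 7 * (2 * 3) + 1 = 8 * 5 + 3 by norm_num, pow_add, pow_mul, h8,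
      one_pow, one_mul]

/-- **W23b♮ on sub-row B — Serre weight `6` on the TAME type-III rows of the tame quartic class (t′) at `3`, at the
canonical local datum.** For `W/ℚ` globally minimal elliptic with `Addv W 3`, `SubTprime W 3`, Kodaira III at `3`
(`ord₃ Δ_min = 3`) and on sub-row B (`c₆ = 0 ∨ 2·ord₃ c₆ ≠ ord₃ Δ + 3`, i.e. `ord₃ c₆ ≠ 3`: no canonical subgroup,
`ℚ₃(E[3])/ℚ₃` tame with `e = 8`), every framing `ρ̄` of `E[3]`, base-changed along any `j : 𝔽₃ → k`, has Serre weight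
`6` at the place `v` of `ℚ` over `3` (`#k_v = 3`, uniformiser `3`) for every residue embedding `ι`: the additive
embedding of `exists_additive_equivariant_of_tprime_subrowB` is `ψ₂⁷`-equivariant, and
`serreWeight_eq_six_of_additive_equivariant_pow_seven` (Serre's semilinear algebra, shape `(1, 2)`) gives
`k = 1 + 3·1 + 2 = 6`. This is the local half of TQMP item W23b (`TprimeIrrKodairaThreeSerreWeightSix`, stmt-28281)
at the canonical datum and on sub-row B; irreducibility of `E[3]` is not needed. Not in print in this form
(Kraus's thesis treats `p ≥ 5`); elementary. [cite: Serre1987, §2.2 (2.2.4)] [cite: SerreInventiones1972, §1.11 Prop. 12] -/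
theorem serreWeight_eq_six_of_tprime_kodairaIII_subrowB
    (W : WeierstrassCurve ℚ) [W.IsElliptic] [W.IsGloballyMinimal]
    (hadd : Rank1Residual.Addv W 3) (hsub : Summit.BirchSwinnertonDyer.Rank1Residual.Additive.SubTprime W 3)
    (h3 : padicValInt 3 W.minimalDiscriminantInt = 3)
    (hB : W.c₆ = 0 ∨ 2 * padicValRat 3 W.c₆ ≠ padicValRat 3 W.Δ + 3)
    (v : HeightOneSpectrum (𝓞 ℚ)) (hv : (primesEquiv v : ℕ) = 3)
    (hq : residueFieldCard (v.adicCompletion ℚ) = 3) (hirr : Irreducible ((3 : ℕ) : 𝒪[v.adicCompletion ℚ]))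
    {ρ : ModPGaloisRep ℚ (ZMod 3) 2} (hρ : W.IsTorsionGaloisRep 3 ρ)
    (k : Type) [Field k] [TopologicalSpace k] [DiscreteTopology k] (j : ZMod 3 →+* k)
    (ι : absIntegers 𝒪[v.adicCompletion ℚ] (v.adicCompletion ℚ) ⧸
      absMaximalIdeal (v.adicCompletion ℚ) →+* k) :
    serreWeight 3 (FramedRep.baseChange j continuous_of_discreteTopology ρ)
      { F := v.adicCompletion ℚ
        residueFieldCard_eq := hq
        irreducible_natCast := hirr
        rep := FramedGaloisRep.restrictField (v.adicCompletion ℚ)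
          (FramedRep.baseChange j continuous_of_discreteTopology ρ)
        rep_eq_restrictField := rfl } ι = 6 := by
  haveI : Fact (Nat.Prime 3) := ⟨Nat.prime_three⟩
  have h3' : padicValRat 3 W.Δ = 3 := by
    rw [← cast_minimalDiscriminantInt W, padicValRat.of_int, h3]; rfl
  obtain ⟨e, he, θ, hθadd, hθinj, hθsmul⟩ :=
    exists_additive_equivariant_of_tprime_subrowB W hadd hsub hB v hv hirr hq ι
  have he7 : e = 7 := by
    rcases he with ⟨-, h⟩ | ⟨h9, -⟩
    · exact h
    · rw [h3'] at h9; norm_num at h9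
  subst he7
  exact W.serreWeight_eq_six_of_additive_equivariant_pow_seven v hq hirr hρ k j ι θ hθadd hθinj hθsmul

/-- **W23a♮ on sub-row B — Serre weight `2` on the TAME type-III* rows of (t′) at `3`, at the canonical local datum.**
Same as `serreWeight_eq_six_of_tprime_kodairaIII_subrowB` for Kodaira III* (`ord₃ Δ_min = 9`, sub-row B:
`c₆ = 0 ∨ ord₃ c₆ ≠ 6`): the embedding is `ψ₂³ = ψ₂^{3¹}`-equivariant, so
`serreWeight_eq_two_of_additive_equivariant_pow` (shape `(0, 1)`, Serre 1987 (2.8.1)) gives weight `2`. The local half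
of TQMP item W23a (`TprimeIrrKodairaThreeStarSerreWeightTwo`, stmt-28283) at the canonical datum, on sub-row B.
[cite: Serre1987, §2.8 Prop. 3 (2.8.1)] [cite: SerreInventiones1972, §1.11 Prop. 12] -/
theorem serreWeight_eq_two_of_tprime_kodairaIIIstar_subrowB
    (W : WeierstrassCurve ℚ) [W.IsElliptic] [W.IsGloballyMinimal]
    (hadd : Rank1Residual.Addv W 3) (hsub : Summit.BirchSwinnertonDyer.Rank1Residual.Additive.SubTprime W 3)
    (h9 : padicValInt 3 W.minimalDiscriminantInt = 9)
    (hB : W.c₆ = 0 ∨ 2 * padicValRat 3 W.c₆ ≠ padicValRat 3 W.Δ + 3)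
    (v : HeightOneSpectrum (𝓞 ℚ)) (hv : (primesEquiv v : ℕ) = 3)
    (hq : residueFieldCard (v.adicCompletion ℚ) = 3) (hirr : Irreducible ((3 : ℕ) : 𝒪[v.adicCompletion ℚ]))
    {ρ : ModPGaloisRep ℚ (ZMod 3) 2} (hρ : W.IsTorsionGaloisRep 3 ρ)
    (k : Type) [Field k] [TopologicalSpace k] [DiscreteTopology k] (j : ZMod 3 →+* k)
    (ι : absIntegers 𝒪[v.adicCompletion ℚ] (v.adicCompletion ℚ) ⧸
      absMaximalIdeal (v.adicCompletion ℚ) →+* k) :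
    serreWeight 3 (FramedRep.baseChange j continuous_of_discreteTopology ρ)
      { F := v.adicCompletion ℚ
        residueFieldCard_eq := hq
        irreducible_natCast := hirr
        rep := FramedGaloisRep.restrictField (v.adicCompletion ℚ)
          (FramedRep.baseChange j continuous_of_discreteTopology ρ)
        rep_eq_restrictField := rfl } ι = 2 := by
  haveI : Fact (Nat.Prime 3) := ⟨Nat.prime_three⟩
  have h9' : padicValRat 3 W.Δ = 9 := by
    rw [← cast_minimalDiscriminantInt W, padicValRat.of_int, h9]; rfl
  obtain ⟨e, he, θ, hθadd, hθinj, hθsmul⟩ :=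
    exists_additive_equivariant_of_tprime_subrowB W hadd hsub hB v hv hirr hq ι
  have he3 : e = 3 := by
    rcases he with ⟨h3, -⟩ | ⟨-, h⟩
    · rw [h9'] at h3; norm_num at h3
    · exact h
  subst he3
  exact W.serreWeight_eq_two_of_additive_equivariant_pow 3 v hq hirr hρ k j ι θ 1 hθadd hθinj
    (by simpa only [pow_one, Nat.cast_ofNat] using hθsmul)

end Summit.BirchSwinnertonDyer.BirchSwinnertonDyer.Theorems.TameQuarticManinParity

end
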